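import Mathlib
import Literature.Analysis.FluidPDE.SwirlTransportProofs
import Literature.Analysis.FluidPDE.SpaceTimeCalculus
import Literature.Analysis.FluidPDE.AxisymSwirlL2Bound
import Literature.Analysis.FluidPDE.KNSSTypeIRateRescaling
import Summits.NavierStokesRegularity.OSWSelfSimilar.TypeIIModulatedWeights
import HarnessLib
/-!
# The MODULATED swirl equation (zone Z1 TEMPLATE §T1.1 (E5) — kernel-checked as one identity)

HONEST FRAMING (cell ns-blowup GROUP B «PROFILE SEARCH», zone Z1 «Type-II log-modulated DSS ansatz for axisymmetric
Navier–Stokes — the template IS the deliverable»; D-0035/D-0074): part VIII of the Z1 dictionary. TEMPLATE (E5): in the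
modulated similarity variables `u(x, t) = λ⁻¹V(τ, y)`, `y = (x − x*)/λ`, `dτ/dt = λ⁻²`, the rescaled swirl `G := r V^θ`
(which IS the physical swirl, `G(y, τ) = Γ(x, t)`, weight 0 — part V `swirl_smul_comp_axisAffine`) satisfies
`∂_τG + a (y·∇)G + ζ·∇G + (V·∇)G = ν(Δ − (2/r)∂ᵣ)G` with `a = −λλ̇`, `ζ = −λẋ*` — a drift–diffusion equation WITHOUT
zeroth-order term. Its two ingredients were already kernel: the physical swirl equation
`Literature.Analysis.FluidPDE.swirl_transport_holds` (KNSS 2009 (1.8): `∂ₜΓ + (u·∇)Γ = ν(ΔΓ − (2/r)∂ᵣΓ) + swirl f`) and the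
chain rule along the moving point `x(t) = x*(t) + λ(t)y`. This file composes them into ONE kernel identity, stated
along the physical clock `t` (so that no inverse clock is needed): for a classical solution on an OPEN time set with
axisymmetric velocity and pressure,

  `d/dt [Γ(t, x*(t) + λ(t)y)] = λ(t)⁻² · ( ν(Δ_yG − (2/r_y)∂_{r_y}G) − (V·∇_y)G − a (y·∇_y)G − ζ·∇_yG )(y) + swirl(f(t))(x)`

with `G = Γ(t, x* + λ ·)`, `V = λ • u(t, x* + λ ·)`, `a = −λλ̇`, `ζ = −λẋ*` (`hasDerivAt_swirl_modulated`); multiplying by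
`dt/dτ = λ²` gives (E5) verbatim (unforced: `f = 0`). On the way: the affine rescaling identities for a scalar field
`G(w) = Γ(x* + λw)` — `fderiv_comp_axisAffine_apply` (`DG(y)w = λ DΓ(x)w`), `laplacian_comp_axisAffine`
(`ΔG(y) = λ² ΔΓ(x)`), `eR_axisAffine` (`e_r(x* + λy) = (λ/|λ|) e_r(y)` for `x*` on the axis),
`radialTerm_comp_axisAffine` (`(2/r_y)∂_{e_r(y)}G(y) = λ² (2/r_x)∂_{e_r(x)}Γ(x)`).

**Nothing here is a statement that a Navier–Stokes solution blows up**: an identity satisfied by every classical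
axisymmetric solution in every gauge. «violates: n/a — dictionary»; bears_on LADDER-NS N5/Z1 → N1 linear core / N0⁻.
Author: ns-blowup-profile-eng-1 g5, 2026-08-27.
-/

open Real Filter Topology Set InnerProductSpace Function
open scoped Laplacian RealInnerProductSpace ContDiff
open Literature.Analysis.FluidPDE

namespace Summit.NavierStokesRegularity.OSWSelfSimilar
namespace TypeIIModulationDictionary

/-! ### 1. Affine rescaling of a scalar field about an axis point -/

section Affine

variable {F : Type*} [NormedAddCommGroup F] [NormedSpace ℝ F]

/-- **`D(Γ(x* + λ ·))(y) w = λ • DΓ(x* + λy) w`** (chain rule with the affine map; no differentiability hypothesis: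
both sides are junk-compatible, Mathlib's `fderiv_comp_smul` / `fderiv_comp_add_left`). [new here — dictionary] -/
theorem fderiv_comp_axisAffine_apply (Γ : EuclideanSpace ℝ (Fin 3) → F) (xc : EuclideanSpace ℝ (Fin 3)) (lam : ℝ)
    (y w : EuclideanSpace ℝ (Fin 3)) :
    fderiv ℝ (fun z => Γ (xc + lam • z)) y w = lam • fderiv ℝ Γ (xc + lam • y) w := by
  have h1 : (fun z => Γ (xc + lam • z)) = fun z => (fun v => Γ (xc + v)) (lam • z) := rfl
  rw [h1, _root_.fderiv_comp_smul (f := fun v => Γ (xc + v)) lam, smul_apply, fderiv_comp_add_left]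

/-- **`Δ(Γ(x* + λ ·))(y) = λ² • (ΔΓ)(x* + λy)`** for `Γ ∈ C²` (translation invariance of `Δ` via
`iteratedFDeriv_comp_add_left`, and the dilation rule). [new here — dictionary] -/
theorem laplacian_comp_axisAffine {F' : Type*} [NormedAddCommGroup F'] [InnerProductSpace ℝ F']
    {Γ : EuclideanSpace ℝ (Fin 3) → F'} (hΓ : ContDiff ℝ 2 Γ) (xc : EuclideanSpace ℝ (Fin 3)) (lam : ℝ)
    (y : EuclideanSpace ℝ (Fin 3)) :
    (Δ (fun z => Γ (xc + lam • z))) y = lam ^ 2 • (Δ Γ) (xc + lam • y) := by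
  -- translation
  have htr : ∀ z, (Δ (fun w => Γ (xc + w))) z = (Δ Γ) (xc + z) := by
    intro z
    rw [InnerProductSpace.laplacian_eq_iteratedFDeriv_orthonormalBasis (fun w => Γ (xc + w))
        (stdOrthonormalBasis ℝ (EuclideanSpace ℝ (Fin 3))),
      InnerProductSpace.laplacian_eq_iteratedFDeriv_orthonormalBasis Γ
        (stdOrthonormalBasis ℝ (EuclideanSpace ℝ (Fin 3)))]
    simp only [iteratedFDeriv_comp_add_left]
  -- dilation: use the tree's `laplacian_smul_comp_smul` on `c • U(c ·)` and peel off the outer `c`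
  have hΓ' : ContDiff ℝ 2 (fun w => Γ (xc + w)) := hΓ.comp (contDiff_const.add contDiff_id)
  by_cases hlam : lam = 0
  · subst hlam
    simp only [zero_smul, add_zero, ne_eq, OfNat.ofNat_ne_zero, not_false_eq_true, zero_pow]
    exact laplacian_const_eq_zero _ _
  · have hd : (Δ (fun z => lam • (fun w => Γ (xc + w)) (lam • z))) y
        = lam ^ 3 • (Δ (fun w => Γ (xc + w))) (lam • y) := laplacian_smul_comp_smul hΓ' lam y
    have hcomp : ContDiff ℝ 2 (fun z => (fun w => Γ (xc + w)) (lam • z)) := hΓ'.comp (contDiff_const_smul lam)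
    have hs : (Δ (fun z => lam • (fun w => Γ (xc + w)) (lam • z))) y
        = lam • (Δ (fun z => (fun w => Γ (xc + w)) (lam • z))) y := by
      rw [show (fun z => lam • (fun w => Γ (xc + w)) (lam • z)) = lam • fun z => (fun w => Γ (xc + w)) (lam • z)
        from rfl, InnerProductSpace.laplacian_smul lam hcomp.contDiffAt]
    rw [hs, htr] at hd
    have hd' := congrArg (fun v => lam⁻¹ • v) hd
    simp only [smul_smul, inv_mul_cancel₀ hlam, one_smul] at hd'
    rw [show (fun z => (fun w => Γ (xc + w)) (lam • z)) = fun z => Γ (xc + lam • z) from rfl] at hd'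
    rw [hd', show lam⁻¹ * lam ^ 3 = lam ^ 2 by field_simp]

/-- **The radial unit vector under an axis-centred dilation**: for `x*` on the axis and `λ ≠ 0`,
`e_r(x* + λ • y) = (λ/|λ|) • e_r(y)` (i.e. `± e_r(y)`). [new here — dictionary] -/
theorem eR_axisAffine {xc : EuclideanSpace ℝ (Fin 3)} (hxc0 : xc 0 = 0) (hxc1 : xc 1 = 0) {lam : ℝ} (hlam : lam ≠ 0)
    (y : EuclideanSpace ℝ (Fin 3)) : eR (xc + lam • y) = (lam / |lam|) • eR y := by
  have habs : |lam| ≠ 0 := abs_ne_zero.mpr hlam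
  simp only [eR, cylRadius_axis_add_smul hxc0 hxc1 lam y, smul_smul]
  by_cases hr : cylRadius y = 0
  · obtain ⟨h0, h1⟩ := (cylRadius_eq_zero_iff y).1 hr
    ext i
    fin_cases i <;> simp [hxc0, hxc1, h0, h1]
  · ext i
    fin_cases i <;> simp [hxc0, hxc1] <;> field_simp

/-- **The radial term has weight 2**: for `x*` on the axis, `λ ≠ 0`, `x = x* + λy` off the axis and `G = Γ(x* + λ ·)`,
`(2/r_y) ∂_{e_r(y)}G(y) = λ² (2/r_x) ∂_{e_r(x)}Γ(x)` (the sign `λ/|λ|` appears twice and squares away).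
[new here — dictionary] -/
theorem radialTerm_comp_axisAffine (Γ : EuclideanSpace ℝ (Fin 3) → ℝ) {xc : EuclideanSpace ℝ (Fin 3)} (hxc0 : xc 0 = 0)
    (hxc1 : xc 1 = 0) {lam : ℝ} (hlam : lam ≠ 0) (y : EuclideanSpace ℝ (Fin 3)) :
    2 / cylRadius y * partialDeriv (eR y) (fun z => Γ (xc + lam • z)) y
      = lam ^ 2 * (2 / cylRadius (xc + lam • y) * partialDeriv (eR (xc + lam • y)) Γ (xc + lam • y)) := by
  simp only [partialDeriv, fderiv_comp_axisAffine_apply, eR_axisAffine hxc0 hxc1 hlam, map_smul, smul_eq_mul,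
    cylRadius_axis_add_smul hxc0 hxc1 lam y]
  by_cases hr : cylRadius y = 0
  · simp [hr]
  · rcases lt_or_gt_of_ne hlam with hneg | hpos
    · rw [abs_of_neg hneg]
      field_simp
    · rw [abs_of_pos hpos]
      field_simp

end Affine

/-! ### 2. The modulated swirl equation -/

section Swirl

variable {S : Set ℝ} {ν : ℝ} {f u : ℝ → EuclideanSpace ℝ (Fin 3) → EuclideanSpace ℝ (Fin 3)}
  {p : ℝ → EuclideanSpace ℝ (Fin 3) → ℝ}

/-- **The chain rule along the moving point** `x(s) = x*(s) + λ(s) • y` for the swirl of a classical solution on an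
OPEN time set: `d/ds [Γ(s, x(s))]|ₜ = ∂ₜΓ(t, x) + DΓ(t, ·)(x)(ẋ* + λ̇ • y)` with `∂ₜΓ = timeDerivWithin S`.
[new here — dictionary] -/
theorem hasDerivAt_swirl_along (hS : IsOpen S) (h : IsClassicalNSSolutionOn S ν f u p) {t : ℝ} (ht : t ∈ S)
    {lam : ℝ → ℝ} {xc : ℝ → EuclideanSpace ℝ (Fin 3)} {dlam : ℝ} {dxc : EuclideanSpace ℝ (Fin 3)}
    (hlam : HasDerivAt lam dlam t) (hxc : HasDerivAt xc dxc t) (y : EuclideanSpace ℝ (Fin 3)) :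
    HasDerivAt (fun s => swirl (u s) (xc s + lam s • y))
      (timeDerivWithin S (fun s => swirl (u s)) t (xc t + lam t • y)
        + fderiv ℝ (swirl (u t)) (xc t + lam t • y) (dxc + dlam • y)) t := by
  set Γ : ℝ → EuclideanSpace ℝ (Fin 3) → ℝ := fun s => swirl (u s) with hΓdef
  have hΓ : IsSmoothSpaceTimeOn S Γ := IsTaoSolutionOn.isSmoothSpaceTimeOn_swirl h.smooth_velocity
  set x : EuclideanSpace ℝ (Fin 3) := xc t + lam t • y with hxdef
  have HΓ : HasFDerivAt (uncurry Γ) (fderiv ℝ (uncurry Γ) (t, x)) (t, x) :=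
    ((hΓ.contDiffAt hS ht x).differentiableAt (by simp)).hasFDerivAt
  have hpath : HasDerivAt (fun s => (s, xc s + lam s • y)) (1, dxc + dlam • y) t :=
    (hasDerivAt_id t).prodMk (hxc.add (hlam.smul_const y))
  have hcomp := HΓ.comp_hasDerivAt t hpath
  have hfun : (uncurry Γ ∘ fun s => (s, xc s + lam s • y)) = fun s => swirl (u s) (xc s + lam s • y) := rfl
  rw [hfun] at hcomp
  refine hcomp.congr_deriv ?_
  -- split the joint derivative into the time line and the slice
  have hsplit : fderiv ℝ (uncurry Γ) (t, x) (1, dxc + dlam • y)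
      = fderiv ℝ (uncurry Γ) (t, x) (1, 0) + fderiv ℝ (uncurry Γ) (t, x) (0, dxc + dlam • y) := by
    rw [← map_add, Prod.mk_add_mk, add_zero, zero_add]
  rw [hsplit, ← hΓ.deriv_timeLine hS ht x, ← hΓ.fderiv_slice_apply_of_isOpen hS ht x,
    timeDerivWithin_eq_deriv hS ht]

/-- **TEMPLATE (E5), the MODULATED swirl equation (kernel).** Let `(u, p)` be a classical solution of Navier–Stokes with
force `f` on an OPEN time set `S`, with axisymmetric velocity and pressure slices, `t ∈ S`; let the gauge have data
`λ(t) ≠ 0`, `λ̇ = dλ/dt`, centre `x*(t)` on the axis with `ẋ* = dx*/dt`, and let `y` be off the axis. With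
`x = x*(t) + λ(t)y`, `G = Γ(t, x* + λ ·)` (`= swirl` of the rescaled profile `V = λ • u(t, x* + λ ·)`, part V),
`a = −λλ̇`, `ζ = −λẋ*`:
`d/dt [Γ(t, x*(t) + λ(t)y)] = λ⁻² (ν(ΔG − (2/r)∂ᵣG)(y) − (V·∇)G(y) − a (y·∇)G(y) − ζ·∇G(y)) + swirl(f(t))(x)`,
i.e. `∂_τG + a y·∇G + ζ·∇G + (V·∇)G = ν(Δ − (2/r)∂ᵣ)G` (+ `λ²·swirl f`) with `dτ = λ⁻²dt` — the tree's
`swirl_transport_holds` (KNSS (1.8)) composed with `hasDerivAt_swirl_along` and the weight identities. [new here — dictionary] -/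
theorem hasDerivAt_swirl_modulated (hS : IsOpen S) (h : IsClassicalNSSolutionOn S ν f u p)
    (hu : ∀ t ∈ S, IsAxisymmetric (u t)) (hp : ∀ t ∈ S, IsAxisymmetricScalar (p t)) {t : ℝ} (ht : t ∈ S)
    {lam : ℝ → ℝ} {xc : ℝ → EuclideanSpace ℝ (Fin 3)} {dlam : ℝ} {dxc : EuclideanSpace ℝ (Fin 3)}
    (hlam : HasDerivAt lam dlam t) (hne : lam t ≠ 0) (hxc : HasDerivAt xc dxc t) (hxc0 : xc t 0 = 0)
    (hxc1 : xc t 1 = 0) {y : EuclideanSpace ℝ (Fin 3)} (hy : cylRadius y ≠ 0) :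
    HasDerivAt (fun s => swirl (u s) (xc s + lam s • y))
      ((lam t)⁻¹ ^ 2 *
          (ν * ((Δ (fun w => swirl (u t) (xc t + lam t • w))) y
                  - 2 / cylRadius y * partialDeriv (eR y) (fun w => swirl (u t) (xc t + lam t • w)) y)
            - fderiv ℝ (fun w => swirl (u t) (xc t + lam t • w)) y (lam t • u t (xc t + lam t • y))
            - (-(lam t * dlam)) * fderiv ℝ (fun w => swirl (u t) (xc t + lam t • w)) y y
            - fderiv ℝ (fun w => swirl (u t) (xc t + lam t • w)) y ((-lam t) • dxc))
        + swirl (f t) (xc t + lam t • y)) t := by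
  have hal := hasDerivAt_swirl_along hS h ht hlam hxc y
  refine hal.congr_deriv ?_
  have hx : cylRadius (xc t + lam t • y) ≠ 0 := by
    rw [cylRadius_axis_add_smul hxc0 hxc1 (lam t) y]
    exact mul_ne_zero (abs_ne_zero.mpr hne) hy
  -- the physical swirl equation at (t, x), solved for the time derivative
  have hsw := swirl_transport_holds h hu hp ht hx
  have key : timeDerivWithin S (fun s => swirl (u s)) t (xc t + lam t • y)
      = ν * ((Δ (swirl (u t))) (xc t + lam t • y)
              - 2 / cylRadius (xc t + lam t • y) * partialDeriv (eR (xc t + lam t • y)) (swirl (u t)) (xc t + lam t • y))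
          + swirl (f t) (xc t + lam t • y) - fderiv ℝ (swirl (u t)) (xc t + lam t • y) (u t (xc t + lam t • y)) :=
    eq_sub_of_add_eq hsw
  have hΓ2 : ContDiff ℝ 2 (swirl (u t)) := contDiff_swirl (h.contDiff_velocity ht |>.of_le (by norm_cast))
  -- rescaling identities at fixed t
  have hD : ∀ w, fderiv ℝ (fun z => swirl (u t) (xc t + lam t • z)) y w
      = lam t * fderiv ℝ (swirl (u t)) (xc t + lam t • y) w := fun w => by
    rw [fderiv_comp_axisAffine_apply, smul_eq_mul]
  have hΔ : (Δ (fun z => swirl (u t) (xc t + lam t • z))) y = lam t ^ 2 * (Δ (swirl (u t))) (xc t + lam t • y) := by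
    rw [laplacian_comp_axisAffine hΓ2, smul_eq_mul]
  have hR := radialTerm_comp_axisAffine (swirl (u t)) hxc0 hxc1 hne y
  have hs1 : fderiv ℝ (swirl (u t)) (xc t + lam t • y) (lam t • u t (xc t + lam t • y))
      = lam t * fderiv ℝ (swirl (u t)) (xc t + lam t • y) (u t (xc t + lam t • y)) := by
    rw [map_smul, smul_eq_mul]
  have hs2 : fderiv ℝ (swirl (u t)) (xc t + lam t • y) ((-lam t) • dxc)
      = (-lam t) * fderiv ℝ (swirl (u t)) (xc t + lam t • y) dxc := by
    rw [map_smul, smul_eq_mul]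
  have hlin : fderiv ℝ (swirl (u t)) (xc t + lam t • y) (dxc + dlam • y)
      = fderiv ℝ (swirl (u t)) (xc t + lam t • y) dxc + dlam * fderiv ℝ (swirl (u t)) (xc t + lam t • y) y := by
    rw [map_add, map_smul, smul_eq_mul]
  rw [hΔ, hR, hD, hD, hD, hs1, hs2, hlin, key]
  field_simp
  ring

end Swirl

end TypeIIModulationDictionary
end Summit.NavierStokesRegularity.OSWSelfSimilar
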